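import Literature.Analysis.FluidPDE.KwonPressureBounds
import Literature.Analysis.FluidPDE.DivPotentialHeatPairing
import HarnessLib

/-!
# Kwon's Lemma 2.5: the force class `f ∈ L¹_t L²_x` and (est.f) at `r = 3`

Analysis/FluidPDE file (theorems only) on the discharge path of the named fact
`Literature.Analysis.FluidPDE.kwon2023_velocity_epsilon_regularity`
(`PressureFreeEpsilonRegularity.lean`; H. Kwon, J. Differential Equations (2023) =
arXiv:2104.03160, Thm. 1.4): the FORCE estimates of Lemma 2.5 for Kwon's explicit force
`f(t) = f_{W(t)}` of the perturbed system (`Kwon2023.forceField W`, `KwonSpaceTimeFields.lean`;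
`Kwon2023.kwonSliceForce`, `KwonSliceMomentum.lean`):

`f_U = −T'_{K_Δ}U − Σᵢ T'_{Kᵢ}(UᵢU) − Σᵢ curl((∂ᵢk) ⋆ (∇φ × UᵢU)) − P[φ♭(h·∇)h]`

(transposed commutators, harmonic-part curl forces, and the classical Leray projection of the
cut-off self-stretching of the harmonic part `h = H U`). PRINTED (arXiv p. 7, Lemma 2.5 (est.f)):
"`‖f‖_{L^{r/2}(a,b;L^∞(B₁))} ≲ ‖u‖_{L^r(a,b;L¹(B₂))} + ‖|u|²‖_{L^{r/2}(a,b;L¹(B₂))}`", and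
Def. 2.4: `f ∈ L¹_t L²_x`. Here `r = 3` (the case used in §4 for Thm. 1.4):

* `Kwon2023.norm_newtonGradPotential_le_of_bound` — the sup bound
  `‖T_a g‖ ≤ ‖a‖(B + (4π)⁻¹‖g‖₁)` for the gradient potentials of a bounded compactly supported
  density (Gilbarg–Trudinger Lemma 4.1);
* slice SUP bounds: `Kwon2023.exists_norm_curlKernelTranspose_commLap_le` (`≤ C‖U‖₁`, the
  linear piece (err.Δu)), `Kwon2023.exists_norm_curlKernelTranspose_commDir_le`,
  `Kwon2023.exists_norm_curl_potentialDeriv_convect_le` (`≤ C‖U‖₂²`),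
  `Kwon2023.exists_norm_classicalLerayProj_selfStretch_le` (`≤ C‖U‖²_{L¹(B₂)}`: `P[F] = F − ∇π[F]`,
  `∂ₐπ[F] = T_a(div F)` with the derivative on the kernel — `fderiv_divPotential_apply` — so that
  only (est.h) at orders `0, 1, 2` is needed), assembled in `Kwon2023.exists_norm_kwonSliceForce_le`:
  `|f_U(y)| ≤ C(‖U‖₁ + ‖U‖₂² + ‖U‖²_{L¹(B₂)})`;
* space–time: `Kwon2023.exists_forall_norm_forceField_le` (`f` is bounded, `u ∈ L^∞_tL²_x`),
  **the `forceClass` field of `Kwon2023.IsPerturbedSuitableOn O … f …`** on every region inside a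
  parabolic cylinder (`Kwon2023.lintegral_sqrt_lintegral_indicator_forceField_sq_lt_top`), and
  **(est.f) in the form of the §4 assembly** `Kwon2023.exists_forceNorm_le`:
  `(∫_{−1}^0 ‖f(t)‖^{3/2}_{L^∞(B₁)})^{2/3} ≤ C(‖W‖_{L³(Q₂(0))} + ‖W‖²_{L³(Q₂(0))})` (slice bound,
  Hölder on `B₂`, Minkowski in `L^{3/2}(dt)` and Hölder on `(−1,0)`).

No NS-regularity statement is touched: these are estimates of a printed lemma on the way to
re-proving the INPUT Thm. 1.4 (the binder `h25` of
`kwon2023_velocity_epsilon_regularity_of_lemma25_of_thm31`, `PressureFreeEpsilonRegularityAssembly.lean`).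

## Mathlib / tree search

Tree (reused): `kwonSliceForce`, `integrable_coord_smul` (`KwonSliceMomentum`); `forceField`,
`IsGoodVelocity` (`KwonSpaceTimeFields`); `curlKernelTranspose`, `norm_curlKernelTranspose_le`,
`exists_norm_curlKernel_le` (`KwonKernelOperators`); `commKernelLap/Dir`,
`contDiff_uncurry_commKernelLap/Dir`, `hasCompactSupport_uncurry_commKernelLap/Dir`
(`KwonCommutatorFields`); `vectorDensity`, `norm_vectorDensity_le`, `integrable_vectorDensity`,
`exists_bound_fderiv_fderiv_annularKernel`, `exists_bound_gradient_kwonCutoff`,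
`exists_norm(_fderiv)_harmonicPart_le`, `norm_integral_comp_sub_smul_le`, `curl_eq_curlCLM`
(`KwonHarmonicPart`); `selfStretch`, `contDiff_selfStretch`, `hasCompactSupport_selfStretch`,
`kwonFlatCutoff` (`KwonConvectiveTransposes`); `exists_norm_fderiv_selfStretch_le`
(`KwonPressureBounds`); `classicalLerayProj_apply`, `contDiff_divergence_of_contDiff_top`
(`ClassicalLerayProjection`); `fderiv_divPotential_apply`, `newtonGradPotential`
(`DivPotentialHeatPairing`, `NewtonGradientPotential`); `norm_fderiv_newtonKernel_le`
(`BiotSavartNewtonKernel`); `nearProfile₂`, `integral_nearProfile₂_norm_eq`;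
`fderiv_convolution_apply_eq` (`MollifiedField`); `divergence_eq_zero_of_notMem_tsupport`
(`WholeSpaceIBP`); `divergence_eq_sum_inner_fderiv`; `tsupport_radialCutoff_subset`.
Mathlib: `eLpNormEssSup_le_of_ae_bound`, `eLpNorm_le_eLpNorm_mul_rpow_measure_univ`,
`ENNReal.lintegral_Lp_add_le` (Minkowski), `ENNReal.lintegral_mul_le_Lp_mul_Lq` with
`Real.HolderConjugate.two_two` (Hölder), `Measurable.lintegral_prod_right'`, `setLIntegral_prod`,
`lintegral_indicator`, `ContinuousLinearMap.opNorm_le_bound`.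

## References

* H. Kwon, *The role of the pressure in the regularity theory for the Navier–Stokes equations*,
  J. Differential Equations 357 (2023) = arXiv:2104.03160: Lemma 2.5 (est.f), (err.Δu), its
  proof (arXiv p. 8–9), Remark 2.3 (est.h), Def. 2.4, §4 (p. 15). [Kwon2023RolePressure]
* D. Gilbarg, N. S. Trudinger, *Elliptic Partial Differential Equations of Second Order*,
  Springer 2001, Lemma 4.1 with (4.9). [GilbargTrudinger2001]
-/

noncomputable section

open MeasureTheory Set Function Filter Topology TopologicalSpace Metric InnerProductSpace
  ContinuousLinearMap
open scoped NNReal ENNReal RealInnerProductSpace Convolution ContDiff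

namespace Literature.Analysis.FluidPDE

namespace Kwon2023

/-! ### A sup bound for the gradient potentials `T_a g = ∫ ∂ₐΓ(· − x) g(x) dx` -/

section GradPotential

/-- **Sup bound for the gradient of the Newtonian potential of a bounded compactly supported
density**: `‖T_a g(y)‖ ≤ ‖a‖ (B + (4π)⁻¹‖g‖_{L¹})` for `|g| ≤ B` (`‖∂ₐΓ(w)‖ ≤ ‖a‖/(4π|w|²)`, split
at `|w| = 1`; `∫_{|w|<1}|w|⁻² = 4π`). [cite: GilbargTrudinger2001, Lemma 4.1 with (4.9)] -/
theorem norm_newtonGradPotential_le_of_bound {g : EuclideanSpace ℝ (Fin 3) → ℝ} (hg : Continuous g)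
    (hgc : HasCompactSupport g) {B : ℝ} (hB : ∀ x, |g x| ≤ B) (a y : EuclideanSpace ℝ (Fin 3)) :
    ‖newtonGradPotential a g y‖ ≤ ‖a‖ * (B + (4 * Real.pi)⁻¹ * ∫ x, |g x|) := by
  have hB0 : 0 ≤ B := (abs_nonneg _).trans (hB 0)
  have hgi : Integrable g := hg.integrable_of_hasCompactSupport hgc
  have hmaj : Integrable fun x : EuclideanSpace ℝ (Fin 3) =>
      ‖a‖ * ((4 * Real.pi)⁻¹ * (B * nearProfile₂ 1 ‖y - x‖ + |g x|)) :=
    (((((integrable_nearProfile₂_norm one_pos).comp_sub_left y).const_mul B).add hgi.abs).const_mul _).const_mul _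
  have hpt : ∀ x, ‖fderiv ℝ newtonKernel (y - x) a • g x‖ ≤
      ‖a‖ * ((4 * Real.pi)⁻¹ * (B * nearProfile₂ 1 ‖y - x‖ + |g x|)) := fun x => by
    rw [norm_smul, Real.norm_eq_abs]
    have hker : ‖fderiv ℝ newtonKernel (y - x) a‖ ≤ (4 * Real.pi * ‖y - x‖ ^ 2)⁻¹ * ‖a‖ :=
      (le_opNorm _ _).trans (mul_le_mul_of_nonneg_right (norm_fderiv_newtonKernel_le _) (norm_nonneg _))
    unfold nearProfile₂
    by_cases h1 : ‖y - x‖ < 1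
    · rw [if_pos h1]
      have hle : (4 * Real.pi * ‖y - x‖ ^ 2)⁻¹ ≤ (4 * Real.pi)⁻¹ * (‖y - x‖ ^ 2)⁻¹ := by
        rw [mul_inv]
      calc ‖fderiv ℝ newtonKernel (y - x) a‖ * |g x|
          ≤ ((4 * Real.pi)⁻¹ * (‖y - x‖ ^ 2)⁻¹ * ‖a‖) * B :=
            mul_le_mul (hker.trans (mul_le_mul_of_nonneg_right hle (norm_nonneg _))) (hB x)
              (abs_nonneg _) (by positivity)
        _ = ‖a‖ * ((4 * Real.pi)⁻¹ * (B * (‖y - x‖ ^ 2)⁻¹)) := by ring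
        _ ≤ ‖a‖ * ((4 * Real.pi)⁻¹ * (B * (‖y - x‖ ^ 2)⁻¹ + |g x|)) := by
            gcongr; exact le_add_of_nonneg_right (abs_nonneg _)
    · rw [if_neg h1, mul_zero, zero_add]
      rw [not_lt] at h1
      have hle : (4 * Real.pi * ‖y - x‖ ^ 2)⁻¹ ≤ (4 * Real.pi)⁻¹ := by
        refine inv_anti₀ (by positivity) ?_
        have hsq : (1 : ℝ) ≤ ‖y - x‖ ^ 2 := by nlinarith
        nlinarith [Real.pi_pos, mul_le_mul_of_nonneg_left hsq (by positivity : (0 : ℝ) ≤ 4 * Real.pi)]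
      calc ‖fderiv ℝ newtonKernel (y - x) a‖ * |g x| ≤ ((4 * Real.pi)⁻¹ * ‖a‖) * |g x| :=
            mul_le_mul_of_nonneg_right (hker.trans (mul_le_mul_of_nonneg_right hle (norm_nonneg _)))
              (abs_nonneg _)
        _ = ‖a‖ * ((4 * Real.pi)⁻¹ * |g x|) := by ring
  rw [newtonGradPotential]
  calc ‖∫ x, fderiv ℝ newtonKernel (y - x) a • g x‖
      ≤ ∫ x, ‖a‖ * ((4 * Real.pi)⁻¹ * (B * nearProfile₂ 1 ‖y - x‖ + |g x|)) :=
        norm_integral_le_of_norm_le hmaj (Eventually.of_forall hpt)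
    _ = ‖a‖ * (B + (4 * Real.pi)⁻¹ * ∫ x, |g x|) := by
        rw [integral_const_mul, integral_const_mul, integral_add (((integrable_nearProfile₂_norm one_pos).comp_sub_left
            y).const_mul B) hgi.abs, integral_const_mul,
          integral_sub_left_eq_self (fun z : EuclideanSpace ℝ (Fin 3) => nearProfile₂ 1 ‖z‖) volume y,
          integral_nearProfile₂_norm_eq one_pos]
        field_simp

end GradPotential

/-! ### Slice sup bounds for the four pieces of Kwon's force -/

section SliceSup

variable {U : EuclideanSpace ℝ (Fin 3) → EuclideanSpace ℝ (Fin 3)}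

/-- `‖Uᵢ U‖ ≤ ‖U‖²`. [folklore] -/
private theorem norm_coord_smul_le (U : EuclideanSpace ℝ (Fin 3) → EuclideanSpace ℝ (Fin 3))
    (i : Fin 3) (x : EuclideanSpace ℝ (Fin 3)) : ‖U x i • U x‖ ≤ ‖U x‖ ^ 2 := by
  rw [norm_smul]
  calc ‖U x i‖ * ‖U x‖ ≤ ‖U x‖ * ‖U x‖ :=
        mul_le_mul_of_nonneg_right (by simpa using PiLp.norm_apply_le (p := 2) (U x) i) (norm_nonneg _)
    _ = ‖U x‖ ^ 2 := by ring

/-- **Sup bound for the transposed `Δ`-commutator** (the linear piece (err.Δu) of the force):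
`|T'_{K_Δ} U(y)| ≤ C ∫|U|`. [cite: Kwon2023RolePressure, Lemma 2.5 (proof, p. 8–9), (err.Δu)–(est.f)] -/
theorem exists_norm_curlKernelTranspose_commLap_le :
    ∃ C : ℝ, 0 ≤ C ∧ ∀ (U : EuclideanSpace ℝ (Fin 3) → EuclideanSpace ℝ (Fin 3)), Integrable U →
      ∀ y, ‖curlKernelTranspose commKernelLap U y‖ ≤ C * ∫ x, ‖U x‖ := by
  obtain ⟨M, hM0, hM⟩ := exists_norm_curlKernel_le (contDiff_uncurry_commKernelLap (n := 1))
    hasCompactSupport_uncurry_commKernelLap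
  exact ⟨M, hM0, fun U hU y => norm_curlKernelTranspose_le hU hM y⟩

/-- **Sup bound for the transposed `∂ᵢ`-commutators of the convective densities**:
`|T'_{Kᵢ}(UᵢU)(y)| ≤ C ∫|U|²`. [cite: Kwon2023RolePressure, Lemma 2.5 (proof, p. 8–9), (est.f)] -/
theorem exists_norm_curlKernelTranspose_commDir_le :
    ∃ C : ℝ, 0 ≤ C ∧ ∀ (U : EuclideanSpace ℝ (Fin 3) → EuclideanSpace ℝ (Fin 3)),
      AEStronglyMeasurable U volume → Integrable (fun x => ‖U x‖ ^ 2) →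
      ∀ (i : Fin 3) y, ‖curlKernelTranspose (commKernelDir (EuclideanSpace.single i (1 : ℝ)))
        (fun x => U x i • U x) y‖ ≤ C * ∫ x, ‖U x‖ ^ 2 := by
  have hb : ∀ i : Fin 3, ∃ M : ℝ, 0 ≤ M ∧ ∀ x y,
      ‖curlKernel (commKernelDir (EuclideanSpace.single i (1 : ℝ))) x y‖ ≤ M := fun i =>
    exists_norm_curlKernel_le (contDiff_uncurry_commKernelDir _ (n := 1)) (hasCompactSupport_uncurry_commKernelDir _)
  choose M hM0 hM using hb
  refine ⟨∑ i, M i, Finset.sum_nonneg fun i _ => hM0 i, fun U hUm hU2 i y => ?_⟩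
  have hUi : Integrable (fun x => U x i • U x) := integrable_coord_smul hUm hU2 i
  refine (norm_curlKernelTranspose_le hUi (hM i) y).trans ?_
  have h1 : ∫ x, ‖U x i • U x‖ ≤ ∫ x, ‖U x‖ ^ 2 :=
    integral_mono_of_nonneg (Eventually.of_forall fun x => norm_nonneg _) hU2
      (Eventually.of_forall fun x => norm_coord_smul_le U i x)
  have h2 : M i ≤ ∑ j, M j := Finset.single_le_sum (fun j _ => hM0 j) (Finset.mem_univ i)
  have h3 : 0 ≤ ∫ x, ‖U x i • U x‖ := integral_nonneg fun x => norm_nonneg _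
  exact mul_le_mul h2 h1 h3 (Finset.sum_nonneg fun j _ => hM0 j)

/-- **Sup bound for the harmonic-part curl forces of the convective densities**:
`|curl((∂ᵢk) ⋆ (∇φ × UᵢU))(y)| ≤ C ∫|U|²` (derivatives on the kernel). [cite: Kwon2023RolePressure, Lemma 2.5 (proof, p. 8–9), (est.f)] -/
theorem exists_norm_curl_potentialDeriv_convect_le :
    ∃ C : ℝ, 0 ≤ C ∧ ∀ (U : EuclideanSpace ℝ (Fin 3) → EuclideanSpace ℝ (Fin 3)),
      AEStronglyMeasurable U volume → Integrable (fun x => ‖U x‖ ^ 2) →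
      ∀ (i : Fin 3) y, ‖curl ((fun z => fderiv ℝ annularKernel z (EuclideanSpace.single i (1 : ℝ)))
        ⋆[lsmul ℝ ℝ, volume] vectorDensity (fun x => U x i • U x)) y‖ ≤ C * ∫ x, ‖U x‖ ^ 2 := by
  obtain ⟨K, hK0, hK⟩ := exists_bound_fderiv_fderiv_annularKernel
  obtain ⟨Cφ, hCφ0, hCφ⟩ := exists_bound_gradient_kwonCutoff
  refine ⟨‖curlCLM‖ * K * Cφ, mul_nonneg (mul_nonneg (norm_nonneg curlCLM) hK0) hCφ0, fun U hUm hU2 i y => ?_⟩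
  have ha1 : ‖(EuclideanSpace.single i (1 : ℝ) : EuclideanSpace ℝ (Fin 3))‖ = 1 := by simp
  have hκs : ContDiff ℝ 1 (fun z => fderiv ℝ annularKernel z (EuclideanSpace.single i (1 : ℝ))) :=
    ((contDiff_annularKernel (n := 2)).fderiv_right (m := 1) le_rfl).clm_apply contDiff_const
  have hκc : HasCompactSupport (fun z => fderiv ℝ annularKernel z (EuclideanSpace.single i (1 : ℝ))) :=
    hasCompactSupport_annularKernel.fderiv_apply (𝕜 := ℝ) _
  have hKc : ∀ z c, ‖fderiv ℝ (fun w => fderiv ℝ annularKernel w (EuclideanSpace.single i (1 : ℝ))) z c‖ ≤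
      K * ‖c‖ := fun z c => by
    have h := hK z c (EuclideanSpace.single i (1 : ℝ))
    rw [ha1, mul_one] at h
    exact h
  have hUi : IntegrableOn (fun x => U x i • U x) (ball (0 : EuclideanSpace ℝ (Fin 3)) 2) :=
    (integrable_coord_smul hUm hU2 i).integrableOn
  have hdi : Integrable (vectorDensity (fun x => U x i • U x)) := integrable_vectorDensity hUi
  have hdl : LocallyIntegrable (vectorDensity (fun x => U x i • U x)) volume := hdi.locallyIntegrable
  have hI : 0 ≤ ∫ t, ‖vectorDensity (fun x => U x i • U x) t‖ := integral_nonneg fun _ => norm_nonneg _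
  have hD : ‖fderiv ℝ ((fun z => fderiv ℝ annularKernel z (EuclideanSpace.single i (1 : ℝ))) ⋆[lsmul ℝ ℝ, volume]
      vectorDensity (fun x => U x i • U x)) y‖ ≤ K * ∫ t, ‖vectorDensity (fun x => U x i • U x) t‖ := by
    refine opNorm_le_bound _ (mul_nonneg hK0 hI) fun c => ?_
    have e := fderiv_convolution_apply_eq hκs hκc hdl y c
    rw [e]
    calc ‖∫ t, (fderiv ℝ (fun w => fderiv ℝ annularKernel w (EuclideanSpace.single i (1 : ℝ))) (y - t) c) •
          vectorDensity (fun x => U x i • U x) t‖ ≤ K * ‖c‖ * ∫ t, ‖vectorDensity (fun x => U x i • U x) t‖ :=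
          norm_integral_comp_sub_smul_le
            (k := fun z => fderiv ℝ (fun w => fderiv ℝ annularKernel w (EuclideanSpace.single i (1 : ℝ))) z c)
            (fun z => hKc z c) hdi y
      _ = K * (∫ t, ‖vectorDensity (fun x => U x i • U x) t‖) * ‖c‖ := by ring
  have hdU : ∫ t, ‖vectorDensity (fun x => U x i • U x) t‖ ≤ Cφ * ∫ x, ‖U x‖ ^ 2 := by
    rw [← integral_const_mul]
    refine integral_mono_of_nonneg (Eventually.of_forall fun x => norm_nonneg _) (hU2.const_mul Cφ)
      (Eventually.of_forall fun x => ?_)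
    calc ‖vectorDensity (fun x => U x i • U x) x‖ ≤ Cφ * ‖U x i • U x‖ := norm_vectorDensity_le hCφ x
      _ ≤ Cφ * ‖U x‖ ^ 2 := mul_le_mul_of_nonneg_left (norm_coord_smul_le U i x) hCφ0
  rw [curl_eq_curlCLM]
  refine (le_opNorm _ _).trans ?_
  calc ‖curlCLM‖ * ‖fderiv ℝ ((fun z => fderiv ℝ annularKernel z (EuclideanSpace.single i (1 : ℝ))) ⋆[lsmul ℝ ℝ, volume]
        vectorDensity (fun x => U x i • U x)) y‖
      ≤ ‖curlCLM‖ * (K * (Cφ * ∫ x, ‖U x‖ ^ 2)) :=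
        mul_le_mul_of_nonneg_left (hD.trans (mul_le_mul_of_nonneg_left hdU hK0)) (norm_nonneg curlCLM)
    _ = ‖curlCLM‖ * K * Cφ * ∫ x, ‖U x‖ ^ 2 := by ring

/-- `|div V(x)| ≤ 3 ‖DV(x)‖` on `ℝ³`. [folklore] -/
private theorem abs_divergence_le_three (V : EuclideanSpace ℝ (Fin 3) → EuclideanSpace ℝ (Fin 3))
    (x : EuclideanSpace ℝ (Fin 3)) : |VectorCalculus.divergence V x| ≤ 3 * ‖fderiv ℝ V x‖ := by
  set b := EuclideanSpace.basisFun (Fin 3) ℝ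
  rw [divergence_eq_sum_inner_fderiv b]
  calc |∑ i, ⟪b i, fderiv ℝ V x (b i)⟫| ≤ ∑ i, |⟪b i, fderiv ℝ V x (b i)⟫| :=
        Finset.abs_sum_le_sum_abs _ _
    _ ≤ ∑ _i : Fin 3, ‖fderiv ℝ V x‖ := Finset.sum_le_sum fun i _ => by
        calc |⟪b i, fderiv ℝ V x (b i)⟫| ≤ ‖b i‖ * ‖fderiv ℝ V x (b i)‖ := abs_real_inner_le_norm _ _
          _ ≤ ‖b i‖ * (‖fderiv ℝ V x‖ * ‖b i‖) :=
              mul_le_mul_of_nonneg_left (le_opNorm _ _) (norm_nonneg _)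
          _ = ‖fderiv ℝ V x‖ := by rw [b.orthonormal.1 i]; ring
    _ = 3 * ‖fderiv ℝ V x‖ := by simp

/-- The self-stretching is supported in the closed ball of radius `9/8`. [folklore] -/
private theorem tsupport_selfStretch_subset (U : EuclideanSpace ℝ (Fin 3) → EuclideanSpace ℝ (Fin 3)) :
    tsupport (selfStretch U) ⊆ closedBall (0 : EuclideanSpace ℝ (Fin 3)) (9 / 8) :=
  (tsupport_smul_subset_left _ _).trans (tsupport_radialCutoff_subset (by norm_num) (by norm_num))

/-- **Sup bound for the Leray projection of the self-stretching**:
`|P[φ♭(h·∇)h](y)| ≤ C (∫_{B₂}|U|)²` — `P[F] = F − ∇π[F]`, `|F| ≤ |∇h||h|`, and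
`∂ₐπ[F] = T_a(div F)` with `div F` bounded and compactly supported ((est.h) at orders `0, 1, 2`).
[cite: Kwon2023RolePressure, Lemma 2.5 (proof, p. 8–9), (est.f)] -/
theorem exists_norm_classicalLerayProj_selfStretch_le :
    ∃ C : ℝ, 0 ≤ C ∧ ∀ (U : EuclideanSpace ℝ (Fin 3) → EuclideanSpace ℝ (Fin 3)),
      IntegrableOn U (ball (0 : EuclideanSpace ℝ (Fin 3)) 2) →
      ∀ y, ‖classicalLerayProj (selfStretch U) y‖ ≤
        C * (∫ x in ball (0 : EuclideanSpace ℝ (Fin 3)) 2, ‖U x‖) ^ 2 := by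
  obtain ⟨C₀, hC₀0, hC₀⟩ := exists_norm_harmonicPart_le
  obtain ⟨C₁, hC₁0, hC₁⟩ := exists_norm_fderiv_harmonicPart_le
  obtain ⟨D, hD0, hD⟩ := exists_norm_fderiv_selfStretch_le
  set v : ℝ := (volume : Measure (EuclideanSpace ℝ (Fin 3))).real
    (closedBall (0 : EuclideanSpace ℝ (Fin 3)) (9 / 8)) with hv
  have hv0 : 0 ≤ v := measureReal_nonneg
  have hπ0 : 0 ≤ (4 * Real.pi)⁻¹ := by positivity
  have hc0 : 0 ≤ 3 * D * (1 + (4 * Real.pi)⁻¹ * v) :=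
    mul_nonneg (mul_nonneg (by norm_num) hD0) (add_nonneg zero_le_one (mul_nonneg hπ0 hv0))
  refine ⟨C₁ * C₀ + 3 * D * (1 + (4 * Real.pi)⁻¹ * v), add_nonneg (mul_nonneg hC₁0 hC₀0) hc0, fun U hU y => ?_⟩
  set I : ℝ := ∫ x in ball (0 : EuclideanSpace ℝ (Fin 3)) 2, ‖U x‖ with hI
  have hI0 : 0 ≤ I := integral_nonneg fun x => norm_nonneg _
  set G := selfStretch U with hG
  have hGs : ContDiff ℝ ∞ G := contDiff_selfStretch hU
  have hGc : HasCompactSupport G := hasCompactSupport_selfStretch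
  have hdivc : Continuous (VectorCalculus.divergence G) := (contDiff_divergence_of_contDiff_top hGs).continuous
  have hsupp : ∀ x, x ∉ closedBall (0 : EuclideanSpace ℝ (Fin 3)) (9 / 8) →
      VectorCalculus.divergence G x = 0 := fun x hx =>
    divergence_eq_zero_of_notMem_tsupport fun h => hx (tsupport_selfStretch_subset U h)
  have hdivcs : HasCompactSupport (VectorCalculus.divergence G) := by
    refine HasCompactSupport.of_support_subset_isCompact (isCompact_closedBall 0 (9 / 8)) fun x hx => ?_
    by_contra h
    exact hx (hsupp x h)
  have hB : ∀ x, |VectorCalculus.divergence G x| ≤ 3 * D * I ^ 2 := fun x =>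
    (abs_divergence_le_three G x).trans (by
      have := hD U hU x
      nlinarith)
  have hL1 : ∫ x, |VectorCalculus.divergence G x| ≤ 3 * D * I ^ 2 * v := by
    rw [← setIntegral_eq_integral_of_forall_compl_eq_zero (s := closedBall (0 : EuclideanSpace ℝ (Fin 3)) (9 / 8))
      (fun x hx => by rw [hsupp x hx, abs_zero])]
    refine (Real.le_norm_self _).trans ?_
    exact norm_setIntegral_le_of_norm_le_const measure_closedBall_lt_top fun x _ => by
      rw [Real.norm_eq_abs, abs_abs]; exact hB x
  -- the field itself
  have hF : ‖G y‖ ≤ C₁ * C₀ * I ^ 2 := by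
    rw [hG, selfStretch, norm_smul]
    have hφ1 : ‖kwonFlatCutoff y‖ ≤ 1 := by
      rw [Real.norm_eq_abs, kwonFlatCutoff, abs_of_nonneg (radialCutoff_nonneg _ _ y)]
      exact radialCutoff_le_one _ _ y
    calc ‖kwonFlatCutoff y‖ * ‖fderiv ℝ (harmonicPart U) y (harmonicPart U y)‖
        ≤ 1 * (‖fderiv ℝ (harmonicPart U) y‖ * ‖harmonicPart U y‖) :=
          mul_le_mul hφ1 (le_opNorm _ _) (norm_nonneg _) zero_le_one
      _ ≤ 1 * ((C₁ * I) * (C₀ * I)) :=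
          mul_le_mul_of_nonneg_left (mul_le_mul (hC₁ U hU y) (hC₀ U hU y) (norm_nonneg _) (mul_nonneg hC₁0 hI0))
            zero_le_one
      _ = C₁ * C₀ * I ^ 2 := by ring
  -- the gradient of the potential
  have hgrad : ‖gradient (divPotential G) y‖ ≤ 3 * D * (1 + (4 * Real.pi)⁻¹ * v) * I ^ 2 := by
    have e : ‖gradient (divPotential G) y‖ = ‖fderiv ℝ (divPotential G) y‖ := by
      rw [gradient, LinearIsometryEquiv.norm_map]
    rw [e]
    refine opNorm_le_bound _ (mul_nonneg hc0 (sq_nonneg _)) fun a => ?_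
    have e2 := fderiv_divPotential_apply hGs hGc y a
    rw [e2]
    refine (norm_newtonGradPotential_le_of_bound hdivc hdivcs hB a y).trans ?_
    rw [mul_comm]
    refine mul_le_mul_of_nonneg_right ?_ (norm_nonneg _)
    nlinarith [mul_le_mul_of_nonneg_left hL1 hπ0]
  rw [classicalLerayProj_apply]
  calc ‖G y - gradient (divPotential G) y‖ ≤ ‖G y‖ + ‖gradient (divPotential G) y‖ := norm_sub_le _ _
    _ ≤ C₁ * C₀ * I ^ 2 + 3 * D * (1 + (4 * Real.pi)⁻¹ * v) * I ^ 2 := add_le_add hF hgrad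
    _ = (C₁ * C₀ + 3 * D * (1 + (4 * Real.pi)⁻¹ * v)) * I ^ 2 := by ring

/-- **Slice sup bound for Kwon's force `f_U`** (all four pieces): for `U ∈ L¹ ∩ L²`,
`|f_U(y)| ≤ C (‖U‖_{L¹} + ‖U‖²_{L²} + ‖U‖²_{L¹(B₂)})` at every `y`. [cite: Kwon2023RolePressure, Lemma 2.5 (proof, p. 8–9), (est.f)] -/
theorem exists_norm_kwonSliceForce_le :
    ∃ C : ℝ, 0 ≤ C ∧ ∀ (U : EuclideanSpace ℝ (Fin 3) → EuclideanSpace ℝ (Fin 3)),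
      AEStronglyMeasurable U volume → Integrable U → Integrable (fun x => ‖U x‖ ^ 2) →
      ∀ y, ‖kwonSliceForce U y‖ ≤ C * ((∫ x, ‖U x‖) + (∫ x, ‖U x‖ ^ 2) +
        (∫ x in ball (0 : EuclideanSpace ℝ (Fin 3)) 2, ‖U x‖) ^ 2) := by
  obtain ⟨A₁, hA₁0, hA₁⟩ := exists_norm_curlKernelTranspose_commLap_le
  obtain ⟨A₂, hA₂0, hA₂⟩ := exists_norm_curlKernelTranspose_commDir_le
  obtain ⟨A₃, hA₃0, hA₃⟩ := exists_norm_curl_potentialDeriv_convect_le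
  obtain ⟨A₄, hA₄0, hA₄⟩ := exists_norm_classicalLerayProj_selfStretch_le
  refine ⟨A₁ + 3 * A₂ + 3 * A₃ + A₄, by positivity, fun U hUm hU1 hU2 y => ?_⟩
  set J : ℝ := ∫ x, ‖U x‖ with hJ
  set S : ℝ := ∫ x, ‖U x‖ ^ 2 with hS
  set I : ℝ := ∫ x in ball (0 : EuclideanSpace ℝ (Fin 3)) 2, ‖U x‖ with hI
  have hJ0 : 0 ≤ J := integral_nonneg fun x => norm_nonneg _
  have hS0 : 0 ≤ S := integral_nonneg fun x => by positivity
  have hI2 : 0 ≤ I ^ 2 := sq_nonneg _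
  have h1 : ‖curlKernelTranspose commKernelLap U y‖ ≤ A₁ * J := hA₁ U hU1 y
  have h2 : ‖∑ i, curlKernelTranspose (commKernelDir (EuclideanSpace.single (i : Fin 3) (1 : ℝ)))
      (fun x => U x i • U x) y‖ ≤ 3 * A₂ * S := by
    calc _ ≤ ∑ i, ‖curlKernelTranspose (commKernelDir (EuclideanSpace.single (i : Fin 3) (1 : ℝ)))
          (fun x => U x i • U x) y‖ := norm_sum_le _ _
      _ ≤ ∑ _i : Fin 3, A₂ * S := Finset.sum_le_sum fun i _ => hA₂ U hUm hU2 i y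
      _ = 3 * A₂ * S := by
          simp only [Finset.sum_const, Finset.card_univ, Fintype.card_fin, nsmul_eq_mul]
          push_cast; ring
  have h3 : ‖∑ i, curl ((fun z => fderiv ℝ annularKernel z (EuclideanSpace.single (i : Fin 3) (1 : ℝ)))
      ⋆[lsmul ℝ ℝ, volume] vectorDensity (fun x => U x i • U x)) y‖ ≤ 3 * A₃ * S := by
    calc _ ≤ ∑ i, ‖curl ((fun z => fderiv ℝ annularKernel z (EuclideanSpace.single (i : Fin 3) (1 : ℝ)))
          ⋆[lsmul ℝ ℝ, volume] vectorDensity (fun x => U x i • U x)) y‖ := norm_sum_le _ _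
      _ ≤ ∑ _i : Fin 3, A₃ * S := Finset.sum_le_sum fun i _ => hA₃ U hUm hU2 i y
      _ = 3 * A₃ * S := by
          simp only [Finset.sum_const, Finset.card_univ, Fintype.card_fin, nsmul_eq_mul]
          push_cast; ring
  have h4 : ‖classicalLerayProj (selfStretch U) y‖ ≤ A₄ * I ^ 2 := hA₄ U hU1.integrableOn y
  rw [kwonSliceForce]
  have t1 : ∀ (p q r w : EuclideanSpace ℝ (Fin 3)), ‖-p - q - r - w‖ ≤ ‖p‖ + ‖q‖ + ‖r‖ + ‖w‖ := by
    intro p q r w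
    calc ‖-p - q - r - w‖ ≤ ‖-p - q - r‖ + ‖w‖ := norm_sub_le _ _
      _ ≤ ‖-p - q‖ + ‖r‖ + ‖w‖ := by gcongr; exact norm_sub_le _ _
      _ ≤ ‖-p‖ + ‖q‖ + ‖r‖ + ‖w‖ := by gcongr; exact norm_sub_le _ _
      _ = ‖p‖ + ‖q‖ + ‖r‖ + ‖w‖ := by rw [norm_neg]
  refine (t1 _ _ _ _).trans ?_
  calc ‖curlKernelTranspose commKernelLap U y‖
        + ‖∑ i, curlKernelTranspose (commKernelDir (EuclideanSpace.single (i : Fin 3) (1 : ℝ)))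
            (fun x => U x i • U x) y‖
        + ‖∑ i, curl ((fun z => fderiv ℝ annularKernel z (EuclideanSpace.single (i : Fin 3) (1 : ℝ)))
            ⋆[lsmul ℝ ℝ, volume] vectorDensity (fun x => U x i • U x)) y‖
        + ‖classicalLerayProj (selfStretch U) y‖
      ≤ A₁ * J + 3 * A₂ * S + 3 * A₃ * S + A₄ * I ^ 2 := add_le_add (add_le_add (add_le_add h1 h2) h3) h4
    _ ≤ (A₁ + 3 * A₂ + 3 * A₃ + A₄) * (J + S + I ^ 2) := by nlinarith

end SliceSup

/-! ### Space–time: the class `f ∈ L¹_t L²_x` and (est.f) at `r = 3` -/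

section SpaceTime

variable {W : ℝ → EuclideanSpace ℝ (Fin 3) → EuclideanSpace ℝ (Fin 3)}

/-- `Q₂(0) = (−4, 0) × B₂`. [folklore] -/
private theorem parabolicCylinder_two_zero :
    parabolicCylinder 2 (0 : ℝ × EuclideanSpace ℝ (Fin 3)) =
      Ioo (-4 : ℝ) 0 ×ˢ ball (0 : EuclideanSpace ℝ (Fin 3)) 2 := by
  rw [parabolicCylinder]
  norm_num

/-- `∫ ‖W(t)‖ = ∫_{B₂} ‖W(t)‖` for a good velocity. [folklore] -/
private theorem integral_norm_slice_eq (hW : IsGoodVelocity W) (t : ℝ) :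
    ∫ x, ‖W t x‖ = ∫ x in ball (0 : EuclideanSpace ℝ (Fin 3)) 2, ‖W t x‖ :=
  (setIntegral_eq_integral_of_forall_compl_eq_zero fun x hx => by
    rw [hW.eq_zero t x hx, norm_zero]).symm

/-- `∫_{B₂} ‖W(t)‖ ≤ |B₂|/2 + A/2` from the uniform `L²` bound. [folklore] -/
private theorem integral_ball_norm_le_const (hW : IsGoodVelocity W) {A : ℝ} (hA : ∀ t, ∫ x, ‖W t x‖ ^ 2 ≤ A)
    (t : ℝ) :
    ∫ y in ball (0 : EuclideanSpace ℝ (Fin 3)) 2, ‖W t y‖ ≤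
      (volume (ball (0 : EuclideanSpace ℝ (Fin 3)) 2)).toReal / 2 + A / 2 := by
  have hfin : volume (ball (0 : EuclideanSpace ℝ (Fin 3)) 2) < ⊤ := measure_ball_lt_top
  have hc1 : Integrable (fun _ : EuclideanSpace ℝ (Fin 3) => (1 / 2 : ℝ))
      (volume.restrict (ball (0 : EuclideanSpace ℝ (Fin 3)) 2)) := integrableOn_const hfin.ne
  have hc2 : Integrable (fun y => ‖W t y‖ ^ 2 / 2)
      (volume.restrict (ball (0 : EuclideanSpace ℝ (Fin 3)) 2)) :=
    ((hW.integrable_sq t).div_const 2).integrableOn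
  have h1 : ∫ y in ball (0 : EuclideanSpace ℝ (Fin 3)) 2, ‖W t y‖ ≤
      ∫ y in ball (0 : EuclideanSpace ℝ (Fin 3)) 2, (1 / 2 + ‖W t y‖ ^ 2 / 2) := by
    refine integral_mono (hW.integrable t).norm.integrableOn (hc1.add hc2) ?_
    intro y
    dsimp only
    nlinarith [sq_nonneg (‖W t y‖ - 1)]
  refine h1.trans ?_
  rw [integral_add hc1 hc2, setIntegral_const, integral_div, smul_eq_mul]
  have h2 : ∫ y in ball (0 : EuclideanSpace ℝ (Fin 3)) 2, ‖W t y‖ ^ 2 ≤ A :=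
    (setIntegral_le_integral (hW.integrable_sq t) (Eventually.of_forall fun y => by positivity)).trans
      (hA t)
  have h3 : (volume.real (ball (0 : EuclideanSpace ℝ (Fin 3)) 2)) =
      (volume (ball (0 : EuclideanSpace ℝ (Fin 3)) 2)).toReal := rfl
  rw [h3]
  linarith

/-- **Kwon's force is uniformly bounded** (for a good velocity, `u ∈ L^∞_t L²_x(Q₂)`):
`‖f(t, y)‖ ≤ M` for all `t, y`. [cite: Kwon2023RolePressure, Lemma 2.5 (est.f) with Def. 1.1] -/
theorem exists_forall_norm_forceField_le (hW : IsGoodVelocity W) :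
    ∃ M : ℝ, ∀ t y, ‖forceField W t y‖ ≤ M := by
  obtain ⟨Cf, hCf0, hCf⟩ := exists_norm_kwonSliceForce_le
  obtain ⟨A, hA⟩ := hW.sq_le_uniform
  set I₀ : ℝ := (volume (ball (0 : EuclideanSpace ℝ (Fin 3)) 2)).toReal / 2 + A / 2 with hI₀
  refine ⟨Cf * (I₀ + A + I₀ ^ 2), fun t y => ?_⟩
  have hI := integral_ball_norm_le_const hW hA t
  have hInn : 0 ≤ ∫ x in ball (0 : EuclideanSpace ℝ (Fin 3)) 2, ‖W t x‖ := integral_nonneg fun x => norm_nonneg _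
  refine (hCf (W t) (hW.aestronglyMeasurable_slice t) (hW.integrable t) (hW.integrable_sq t) y).trans ?_
  rw [integral_norm_slice_eq hW t]
  refine mul_le_mul_of_nonneg_left ?_ hCf0
  have h2 : (∫ x in ball (0 : EuclideanSpace ℝ (Fin 3)) 2, ‖W t x‖) ^ 2 ≤ I₀ ^ 2 := by gcongr
  linarith [hA t]

/-- **The `forceClass` field of `Kwon2023.IsPerturbedSuitableOn O … f …`** for Kwon's force
`f = forceField W` on any region `O` inside a parabolic cylinder `Q_r(z₀)` (e.g. `Q₁(0)`):
`∫ (∫ 1_O |f|²dx)^{1/2} dt < ∞` (`f` is bounded). [cite: Kwon2023RolePressure, Lemma 2.5 (est.f) with Def. 2.4] -/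
theorem lintegral_sqrt_lintegral_indicator_forceField_sq_lt_top (hW : IsGoodVelocity W) (r : ℝ)
    (z₀ : ℝ × EuclideanSpace ℝ (Fin 3)) {O : Set (ℝ × EuclideanSpace ℝ (Fin 3))}
    (hO : O ⊆ parabolicCylinder r z₀) :
    ∫⁻ t, (∫⁻ x, O.indicator (fun z : ℝ × EuclideanSpace ℝ (Fin 3) => ‖forceField W z.1 z.2‖ₑ ^ 2) (t, x))
      ^ (1 / 2 : ℝ) < ⊤ := by
  obtain ⟨M, hM⟩ := exists_forall_norm_forceField_le hW
  have hM0 : 0 ≤ M := (norm_nonneg _).trans (hM 0 0)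
  set J : Set ℝ := Ioo (z₀.1 - r ^ 2) z₀.1 with hJ
  set K : ℝ≥0∞ := (volume (ball z₀.2 r) * ENNReal.ofReal M ^ 2) ^ (1 / 2 : ℝ) with hK
  have hKtop : K ≠ ⊤ := ENNReal.rpow_ne_top_of_nonneg (by norm_num)
    (ENNReal.mul_ne_top measure_ball_lt_top.ne (ENNReal.pow_ne_top ENNReal.ofReal_ne_top))
  -- pointwise in `t`
  have hpt : ∀ t, (∫⁻ x, O.indicator (fun z : ℝ × EuclideanSpace ℝ (Fin 3) => ‖forceField W z.1 z.2‖ₑ ^ 2) (t, x))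
      ^ (1 / 2 : ℝ) ≤ J.indicator (fun _ => K) t := by
    intro t
    by_cases ht : t ∈ J
    · rw [indicator_of_mem ht, hK]
      gcongr
      calc ∫⁻ x, O.indicator (fun z : ℝ × EuclideanSpace ℝ (Fin 3) => ‖forceField W z.1 z.2‖ₑ ^ 2) (t, x)
          ≤ ∫⁻ x, (ball z₀.2 r).indicator (fun _ => ENNReal.ofReal M ^ 2) x := by
            refine lintegral_mono fun x => ?_
            by_cases hx : (t, x) ∈ O
            · have hxb : x ∈ ball z₀.2 r := ((mem_parabolicCylinder).1 (hO hx)).2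
              rw [indicator_of_mem hx, indicator_of_mem hxb]
              gcongr
              rw [← ofReal_norm]
              exact ENNReal.ofReal_le_ofReal (hM t x)
            · rw [indicator_of_notMem hx]
              exact zero_le
        _ = volume (ball z₀.2 r) * ENNReal.ofReal M ^ 2 := by
            rw [lintegral_indicator measurableSet_ball, setLIntegral_const, mul_comm]
    · rw [indicator_of_notMem ht]
      have h0 : ∀ x, O.indicator (fun z : ℝ × EuclideanSpace ℝ (Fin 3) => ‖forceField W z.1 z.2‖ₑ ^ 2) (t, x) = 0 := by
        intro x
        rw [indicator_of_notMem]
        intro h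
        exact ht ((mem_parabolicCylinder).1 (hO h)).1
      simp_rw [h0]
      rw [lintegral_zero, ENNReal.zero_rpow_of_pos (by norm_num)]
  calc ∫⁻ t, (∫⁻ x, O.indicator (fun z : ℝ × EuclideanSpace ℝ (Fin 3) => ‖forceField W z.1 z.2‖ₑ ^ 2) (t, x))
        ^ (1 / 2 : ℝ)
      ≤ ∫⁻ t, J.indicator (fun _ => K) t := lintegral_mono hpt
    _ = K * volume J := by rw [lintegral_indicator measurableSet_Ioo, setLIntegral_const]
    _ < ⊤ := ENNReal.mul_lt_top hKtop.lt_top measure_Ioo_lt_top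

/-- Hölder on `B₂`: `∫_{B₂} ‖W(t)‖ ≤ |B₂|^{2/3} ‖W(t)‖_{L³(B₂)}`, in `ℝ≥0∞`. [folklore] -/
private theorem ofReal_integral_ball_norm_le (hW : IsGoodVelocity W) (t : ℝ) :
    ENNReal.ofReal (∫ y in ball (0 : EuclideanSpace ℝ (Fin 3)) 2, ‖W t y‖) ≤
      volume (ball (0 : EuclideanSpace ℝ (Fin 3)) 2) ^ (2 / 3 : ℝ) *
        eLpNorm (W t) 3 (volume.restrict (ball (0 : EuclideanSpace ℝ (Fin 3)) 2)) := by
  rw [ofReal_integral_norm_eq_lintegral_enorm (hW.integrableOn_slice t),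
    ← eLpNorm_one_eq_lintegral_enorm]
  have h := eLpNorm_le_eLpNorm_mul_rpow_measure_univ (p := 1) (q := 3)
    (μ := volume.restrict (ball (0 : EuclideanSpace ℝ (Fin 3)) 2)) (by norm_num)
    ((hW.aestronglyMeasurable_slice t).restrict)
  rw [Measure.restrict_apply_univ] at h
  have e : (1 / (1 : ℝ≥0∞).toReal - 1 / (3 : ℝ≥0∞).toReal : ℝ) = 2 / 3 := by norm_num
  rw [e] at h
  rw [mul_comm]
  exact h

/-- Hölder on `B₂`: `∫ ‖W(t)‖² ≤ |B₂|^{1/3} ‖W(t)‖²_{L³(B₂)}`, in `ℝ≥0∞`. [folklore] -/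
private theorem ofReal_integral_sq_le (hW : IsGoodVelocity W) (t : ℝ) :
    ENNReal.ofReal (∫ y, ‖W t y‖ ^ 2) ≤
      volume (ball (0 : EuclideanSpace ℝ (Fin 3)) 2) ^ (1 / 3 : ℝ) *
        eLpNorm (W t) 3 (volume.restrict (ball (0 : EuclideanSpace ℝ (Fin 3)) 2)) ^ 2 := by
  set μ₂ : Measure (EuclideanSpace ℝ (Fin 3)) := volume.restrict (ball (0 : EuclideanSpace ℝ (Fin 3)) 2)
    with hμ₂
  have hint : ∫ y, ‖W t y‖ ^ 2 = ∫ y in ball (0 : EuclideanSpace ℝ (Fin 3)) 2, ‖W t y‖ ^ 2 :=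
    (setIntegral_eq_integral_of_forall_compl_eq_zero fun y hy => by
      rw [hW.eq_zero t y hy, norm_zero]; ring).symm
  have h2 : ENNReal.ofReal (∫ y in ball (0 : EuclideanSpace ℝ (Fin 3)) 2, ‖W t y‖ ^ 2) =
      eLpNorm (W t) 2 μ₂ ^ 2 := by
    rw [ofReal_integral_eq_lintegral_ofReal (hW.integrable_sq t).integrableOn
      (Eventually.of_forall fun y => by positivity)]
    have e : ∀ y, ENNReal.ofReal (‖W t y‖ ^ 2) = ‖W t y‖ₑ ^ (2 : ℝ) := fun y => by
      rw [ENNReal.ofReal_pow (norm_nonneg _), ofReal_norm, ← ENNReal.rpow_natCast]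
      norm_num
    simp_rw [e]
    rw [← hμ₂, eLpNorm_eq_lintegral_rpow_enorm_toReal (by norm_num) (by norm_num), ENNReal.toReal_ofNat,
      ← ENNReal.rpow_natCast, ← ENNReal.rpow_mul]
    norm_num
  have h := eLpNorm_le_eLpNorm_mul_rpow_measure_univ (p := 2) (q := 3) (μ := μ₂) (by norm_num)
    ((hW.aestronglyMeasurable_slice t).restrict)
  rw [hμ₂, Measure.restrict_apply_univ] at h
  have e : (1 / (2 : ℝ≥0∞).toReal - 1 / (3 : ℝ≥0∞).toReal : ℝ) = 1 / 6 := by norm_num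
  rw [e, ← hμ₂] at h
  rw [hint, h2]
  calc eLpNorm (W t) 2 μ₂ ^ 2
      ≤ (eLpNorm (W t) 3 μ₂ * volume (ball (0 : EuclideanSpace ℝ (Fin 3)) 2) ^ (1 / 6 : ℝ)) ^ 2 := by
        gcongr
    _ = volume (ball (0 : EuclideanSpace ℝ (Fin 3)) 2) ^ (1 / 3 : ℝ) * eLpNorm (W t) 3 μ₂ ^ 2 := by
        rw [mul_pow, ← ENNReal.rpow_natCast (volume _ ^ (1 / 6 : ℝ)), ← ENNReal.rpow_mul]
        norm_num
        rw [mul_comm]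

/-- **(est.f) at `r = 3`, in the form of the §4 assembly.** There is an absolute `C > 0` such
that for every good velocity `W` (a representative of the velocity on `Q₂(0) = (−4,0) × B₂`, zero
off `B₂`), Kwon's force satisfies
`(∫_{−1}^{0} ‖f(t)‖^{3/2}_{L^∞(B₁)} dt)^{2/3} ≤ C (‖W‖_{L³(Q₂(0))} + ‖W‖²_{L³(Q₂(0))})` — Lemma 2.5
(est.f) "`‖f‖_{L^{r/2}(−4,0;L^∞(B₁))} ≲ ‖u‖_{L^r(−4,0;L¹(B₂))} + ‖|u|²‖_{L^{r/2}(−4,0;L¹(B₂))}`"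
with `r = 3`, followed by Hölder on `B₂` and on `(−1, 0)`, as used in §4
("`‖f‖_{L^{r/2}_tL^∞_x(Q₁)} ≤ C₁(‖u‖ + ‖u‖²)`"). [cite: Kwon2023RolePressure, Lemma 2.5 (est.f) with r = 3; §4 (arXiv p. 15)] -/
theorem exists_forceNorm_le :
    ∃ C : ℝ, 0 < C ∧ ∀ (W : ℝ → EuclideanSpace ℝ (Fin 3) → EuclideanSpace ℝ (Fin 3)), IsGoodVelocity W →
      (∫⁻ t in Ioo (-1 : ℝ) 0, eLpNorm (forceField W t) ∞
          (volume.restrict (ball (0 : EuclideanSpace ℝ (Fin 3)) 1)) ^ (3 / 2 : ℝ)) ^ (2 / 3 : ℝ) ≤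
        ENNReal.ofReal C * (eLpNorm (uncurry W) 3
            (volume.restrict (parabolicCylinder 2 (0 : ℝ × EuclideanSpace ℝ (Fin 3)))) +
          eLpNorm (uncurry W) 3
            (volume.restrict (parabolicCylinder 2 (0 : ℝ × EuclideanSpace ℝ (Fin 3)))) ^ 2) := by
  obtain ⟨Cf, hCf0, hCf⟩ := exists_norm_kwonSliceForce_le
  -- the constants
  set B₂ : Set (EuclideanSpace ℝ (Fin 3)) := ball (0 : EuclideanSpace ℝ (Fin 3)) 2 with hB₂
  have hB₂fin : volume B₂ ≠ ⊤ := measure_ball_lt_top.ne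
  set k₁ : ℝ≥0∞ := volume B₂ ^ (2 / 3 : ℝ) with hk₁
  set k₂ : ℝ≥0∞ := volume B₂ ^ (1 / 3 : ℝ) with hk₂
  set k₄ : ℝ≥0∞ := volume B₂ ^ (4 / 3 : ℝ) with hk₄
  have hk : k₁ ^ 2 = k₄ := by
    rw [hk₁, hk₄, ← ENNReal.rpow_natCast, ← ENNReal.rpow_mul]; norm_num
  set α : ℝ≥0∞ := ENNReal.ofReal Cf * k₁ with hα
  set β : ℝ≥0∞ := ENNReal.ofReal Cf * (k₂ + k₄) with hβ
  have hαtop : α ≠ ⊤ := ENNReal.mul_ne_top ENNReal.ofReal_ne_top (ENNReal.rpow_ne_top_of_nonneg (by norm_num) hB₂fin)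
  have hβtop : β ≠ ⊤ := ENNReal.mul_ne_top ENNReal.ofReal_ne_top (ENNReal.add_ne_top.2
    ⟨ENNReal.rpow_ne_top_of_nonneg (by norm_num) hB₂fin, ENNReal.rpow_ne_top_of_nonneg (by norm_num) hB₂fin⟩)
  have hctop : α + β ≠ ⊤ := ENNReal.add_ne_top.2 ⟨hαtop, hβtop⟩
  refine ⟨(α + β).toReal + 1, by positivity, fun W hW => ?_⟩
  set μ₁ : Measure (EuclideanSpace ℝ (Fin 3)) := volume.restrict (ball (0 : EuclideanSpace ℝ (Fin 3)) 1) with hμ₁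
  set μ₂ : Measure (EuclideanSpace ℝ (Fin 3)) := volume.restrict B₂ with hμ₂
  set X : ℝ≥0∞ := eLpNorm (uncurry W) 3
    (volume.restrict (parabolicCylinder 2 (0 : ℝ × EuclideanSpace ℝ (Fin 3)))) with hXdef
  -- the slice `L³(B₂)` norms as a measurable function of `t`
  set N : ℝ → ℝ≥0∞ := fun t => (∫⁻ y, ‖W t y‖ₑ ^ (3 : ℝ) ∂μ₂) ^ (1 / 3 : ℝ) with hN
  have hNeq : ∀ t, eLpNorm (W t) 3 μ₂ = N t := fun t => by
    rw [hN, eLpNorm_eq_lintegral_rpow_enorm_toReal (by norm_num) (by norm_num), ENNReal.toReal_ofNat]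
  have hN3 : ∀ t, N t ^ (3 : ℝ) = ∫⁻ y, ‖W t y‖ₑ ^ (3 : ℝ) ∂μ₂ := fun t => by
    rw [hN]; dsimp only; rw [← ENNReal.rpow_mul]; norm_num
  have hNm : Measurable N := by
    have h : Measurable fun t => ∫⁻ y, (fun z : ℝ × EuclideanSpace ℝ (Fin 3) => ‖uncurry W z‖ₑ ^ (3 : ℝ)) (t, y) ∂μ₂ :=
      (hW.stronglyMeasurable.measurable.enorm.pow_const _).lintegral_prod_right'
    exact h.pow_const _
  -- ### the slice bound `‖f(t)‖_{L^∞(B₁)} ≤ α N(t) + β N(t)²`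
  have hsl : ∀ t, eLpNorm (forceField W t) ∞ μ₁ ≤ α * N t + β * N t ^ 2 := by
    intro t
    set I : ℝ := ∫ x in B₂, ‖W t x‖ with hI
    set S : ℝ := ∫ x, ‖W t x‖ ^ 2 with hS
    have hI0 : 0 ≤ I := integral_nonneg fun x => norm_nonneg _
    have hS0 : 0 ≤ S := integral_nonneg fun x => by positivity
    have hb : ∀ y, ‖forceField W t y‖ ≤ Cf * (I + S + I ^ 2) := fun y => by
      have h := hCf (W t) (hW.aestronglyMeasurable_slice t) (hW.integrable t) (hW.integrable_sq t) y
      rw [integral_norm_slice_eq hW t] at h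
      exact h
    have h1 : eLpNorm (forceField W t) ∞ μ₁ ≤ ENNReal.ofReal (Cf * (I + S + I ^ 2)) := by
      rw [eLpNorm_exponent_top]
      exact eLpNormEssSup_le_of_ae_bound (Eventually.of_forall hb)
    refine h1.trans ?_
    have hIe : ENNReal.ofReal I ≤ k₁ * N t := by rw [← hNeq t]; exact ofReal_integral_ball_norm_le hW t
    have hSe : ENNReal.ofReal S ≤ k₂ * N t ^ 2 := by rw [← hNeq t]; exact ofReal_integral_sq_le hW t
    rw [ENNReal.ofReal_mul hCf0, ENNReal.ofReal_add (by positivity) (sq_nonneg _), ENNReal.ofReal_add hI0 hS0,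
      ENNReal.ofReal_pow hI0]
    calc ENNReal.ofReal Cf * (ENNReal.ofReal I + ENNReal.ofReal S + ENNReal.ofReal I ^ 2)
        ≤ ENNReal.ofReal Cf * (k₁ * N t + k₂ * N t ^ 2 + (k₁ * N t) ^ 2) := by gcongr
      _ = α * N t + β * N t ^ 2 := by rw [mul_pow, hk, hα, hβ]; ring
  -- ### time integration on `(−1, 0)`
  set μT : Measure ℝ := volume.restrict (Ioo (-1 : ℝ) 0) with hμT
  have hT1 : μT univ = 1 := by
    rw [hμT, Measure.restrict_apply_univ, Real.volume_Ioo]; norm_num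
  have hαN : AEMeasurable (fun t => α * N t) μT := (hNm.const_mul α).aemeasurable
  have hβN : AEMeasurable (fun t => β * N t ^ 2) μT := ((hNm.pow_const 2).const_mul β).aemeasurable
  -- Minkowski in `L^{3/2}(dt)`
  have hMink : (∫⁻ t, (α * N t + β * N t ^ 2) ^ (3 / 2 : ℝ) ∂μT) ^ (2 / 3 : ℝ) ≤
      (∫⁻ t, (α * N t) ^ (3 / 2 : ℝ) ∂μT) ^ (2 / 3 : ℝ) + (∫⁻ t, (β * N t ^ 2) ^ (3 / 2 : ℝ) ∂μT) ^ (2 / 3 : ℝ) := by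
    have h := ENNReal.lintegral_Lp_add_le (μ := μT) hαN hβN (by norm_num : (1 : ℝ) ≤ 3 / 2)
    have e : (1 / (3 / 2 : ℝ)) = 2 / 3 := by norm_num
    rw [e] at h
    exact h
  -- constants out
  have hA : (∫⁻ t, (α * N t) ^ (3 / 2 : ℝ) ∂μT) ^ (2 / 3 : ℝ) = α * (∫⁻ t, N t ^ (3 / 2 : ℝ) ∂μT) ^ (2 / 3 : ℝ) := by
    have e : ∀ t, (α * N t) ^ (3 / 2 : ℝ) = α ^ (3 / 2 : ℝ) * N t ^ (3 / 2 : ℝ) := fun t =>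
      ENNReal.mul_rpow_of_nonneg _ _ (by norm_num)
    simp_rw [e]
    rw [lintegral_const_mul _ (hNm.pow_const _), ENNReal.mul_rpow_of_nonneg _ _ (by norm_num),
      ← ENNReal.rpow_mul]
    norm_num
  have hB : (∫⁻ t, (β * N t ^ 2) ^ (3 / 2 : ℝ) ∂μT) ^ (2 / 3 : ℝ) = β * (∫⁻ t, N t ^ (3 : ℝ) ∂μT) ^ (2 / 3 : ℝ) := by
    have e : ∀ t, (β * N t ^ 2) ^ (3 / 2 : ℝ) = β ^ (3 / 2 : ℝ) * N t ^ (3 : ℝ) := fun t => by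
      rw [ENNReal.mul_rpow_of_nonneg _ _ (by norm_num), ← ENNReal.rpow_natCast (N t), ← ENNReal.rpow_mul]
      norm_num
    simp_rw [e]
    rw [lintegral_const_mul _ (hNm.pow_const _), ENNReal.mul_rpow_of_nonneg _ _ (by norm_num),
      ← ENNReal.rpow_mul]
    norm_num
  -- Hölder on `(−1, 0)`: `(∫ N^{3/2})^{2/3} ≤ (∫ N³)^{1/3}`
  have hHol : (∫⁻ t, N t ^ (3 / 2 : ℝ) ∂μT) ^ (2 / 3 : ℝ) ≤ (∫⁻ t, N t ^ (3 : ℝ) ∂μT) ^ (1 / 3 : ℝ) := by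
    have h := ENNReal.lintegral_mul_le_Lp_mul_Lq μT Real.HolderConjugate.two_two
      (f := fun t => N t ^ (3 / 2 : ℝ)) (g := fun _ => 1) (hNm.pow_const _).aemeasurable aemeasurable_const
    have e1 : ∀ t, (N t ^ (3 / 2 : ℝ)) ^ (2 : ℝ) = N t ^ (3 : ℝ) := fun t => by
      rw [← ENNReal.rpow_mul]; norm_num
    simp only [Pi.mul_apply, mul_one, e1, ENNReal.one_rpow, lintegral_const, hT1, mul_one] at h
    calc (∫⁻ t, N t ^ (3 / 2 : ℝ) ∂μT) ^ (2 / 3 : ℝ)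
        ≤ ((∫⁻ t, N t ^ (3 : ℝ) ∂μT) ^ (1 / 2 : ℝ)) ^ (2 / 3 : ℝ) := by gcongr
      _ = (∫⁻ t, N t ^ (3 : ℝ) ∂μT) ^ (1 / 3 : ℝ) := by rw [← ENNReal.rpow_mul]; norm_num
  -- `∫_{−1}^0 N³ ≤ X³`
  have hmeasW : AEMeasurable (fun z : ℝ × EuclideanSpace ℝ (Fin 3) => ‖uncurry W z‖ₑ ^ (3 : ℝ))
      (((volume : Measure ℝ).prod (volume : Measure (EuclideanSpace ℝ (Fin 3)))).restrict
        (Ioo (-4 : ℝ) 0 ×ˢ B₂)) :=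
    (hW.stronglyMeasurable.measurable.enorm.pow_const _).aemeasurable
  have hX3 : ∫⁻ t, N t ^ (3 : ℝ) ∂μT ≤ X ^ (3 : ℝ) := by
    have e : X ^ (3 : ℝ) = ∫⁻ t in Ioo (-4 : ℝ) 0, N t ^ (3 : ℝ) := by
      rw [hXdef, eLpNorm_eq_lintegral_rpow_enorm_toReal (by norm_num) (by norm_num), ENNReal.toReal_ofNat,
        ← ENNReal.rpow_mul, parabolicCylinder_two_zero, Measure.volume_eq_prod,
        show ((1 / 3 * 3 : ℝ)) = 1 by norm_num, ENNReal.rpow_one, ← hB₂, setLIntegral_prod _ hmeasW]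
      simp_rw [hN3]
      rfl
    rw [e, hμT]
    exact lintegral_mono_set (Ioo_subset_Ioo (by norm_num) le_rfl)
  -- ### conclusion
  have hc : ENNReal.ofReal ((α + β).toReal + 1) = α + β + 1 := by
    rw [ENNReal.ofReal_add ENNReal.toReal_nonneg zero_le_one, ENNReal.ofReal_toReal hctop, ENNReal.ofReal_one]
  calc (∫⁻ t in Ioo (-1 : ℝ) 0, eLpNorm (forceField W t) ∞ μ₁ ^ (3 / 2 : ℝ)) ^ (2 / 3 : ℝ)
      ≤ (∫⁻ t, (α * N t + β * N t ^ 2) ^ (3 / 2 : ℝ) ∂μT) ^ (2 / 3 : ℝ) := by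
        rw [← hμT]; gcongr with t; exact hsl t
    _ ≤ α * (∫⁻ t, N t ^ (3 / 2 : ℝ) ∂μT) ^ (2 / 3 : ℝ) + β * (∫⁻ t, N t ^ (3 : ℝ) ∂μT) ^ (2 / 3 : ℝ) := by
        rw [← hA, ← hB]; exact hMink
    _ ≤ α * X + β * X ^ 2 := by
        gcongr
        · calc (∫⁻ t, N t ^ (3 / 2 : ℝ) ∂μT) ^ (2 / 3 : ℝ) ≤ (∫⁻ t, N t ^ (3 : ℝ) ∂μT) ^ (1 / 3 : ℝ) := hHol
            _ ≤ (X ^ (3 : ℝ)) ^ (1 / 3 : ℝ) := by gcongr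
            _ = X := by rw [← ENNReal.rpow_mul]; norm_num
        · calc (∫⁻ t, N t ^ (3 : ℝ) ∂μT) ^ (2 / 3 : ℝ) ≤ (X ^ (3 : ℝ)) ^ (2 / 3 : ℝ) := by gcongr
            _ = X ^ 2 := by rw [← ENNReal.rpow_mul, ← ENNReal.rpow_natCast X]; norm_num
    _ ≤ (α + β + 1) * X + (α + β + 1) * X ^ 2 := by
        gcongr
        · exact le_add_right le_self_add
        · exact le_add_right le_add_self
    _ = ENNReal.ofReal ((α + β).toReal + 1) * (X + X ^ 2) := by rw [hc]; ring

end SpaceTime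

end Kwon2023

end Literature.Analysis.FluidPDE

end
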